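import Summits.QuantumFields.YangMills.Theorems.UnitScaleTiltProp7LODMemberWindow
import Summits.QuantumFields.YangMills.Theorems.UnitScaleTiltProp7LODBudgetLetters
import Summits.QuantumFields.YangMills.Theorems.UnitScaleTiltProp7LODSlotK2WindowLetters
import HarnessLib

/-!
# Route `UnitScaleTilt`, crux K1 «MinimiserStabilityRegPr» (stmt-QuantumFields-19200), EX row `hGF[Lift]` — **LOD LINE (L6), CLOSING KNIT (D3c):
# THE NUMERIC-LETTER PACK** — every ε₀-free and every ε₀-dependent NUMERIC hypothesis of px10 g11's (D2)
# `Prop7LODTargetClosed.curvedTarget_member_numeric` (the curved LOD target at ONE large member, closed down to numeric letters), produced AT ONCE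
# as one ∃-statement in pure real arithmetic: (D3a) ✓`Prop7LODMemberWindow.exists_window_letters` (w2-19200 g12: `θc δP α γ₁ s`, `3θc + δP ≤ 1`, coefficient `≥ γ₁`)
# ⊕ (D3b) ✓`Prop7LODBudgetLetters.exists_budget_letters` (`ν Bt Rb ε₁`: the three quarter-budgets of ✓`Prop7LocalProjectorRowCubeWindow.deltaPmax_le_of_budget` with
# `cG cQ εN` := the SHORT K-free letter bounds of ✓`Prop7LocalProjectorRowCubeLetterBounds` (routeR-w3 g13), and `24ε₀(Rb+9) ≤ 1`) ⊕ the slope letters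
# ✓`Prop7LODBudgetLetters.mu_pos`∕`ten_mu_le_one` and ✓`Prop7LODSlotK2WindowLetters.window_win` ⊕ the caps `10¹⁰Λ⁶ε₀ ≤ 1`, `10¹²Λ³ε₀ ≤ 1`, glued by
# `εcap := min α (min ε₁ (min (10¹⁰Λ⁶)⁻¹ (10¹²Λ³)⁻¹))`, `Bc := Bt + 1`, `r := max r₀(am, δP) 1`, `μa := μ(am)`, `κP := √(CP(am)∕(Λ^s)²)`; `1 ≤ s` is DERIVED
# (at `s = 0` the window's coefficient is `< 0 < γ₁`).

Cell `ym3-torus` (HUMAN RULING D-0037, YM ladder rung R3 — SU(2) YM₃ on T³; NOT d = 4, NOT infinite volume, NOT a mass gap, NOT Clay).  Width seat `ym-routeR-w4` gen 27,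
(D3c) of px10 g11's CLOSING-KNIT PLAN v2 (2026-08-30 05:17:41Z; w2-19200 g12 05:42:02Z «GO routeR-w4 on D3c»).  THEOREMS ONLY (0 `def`, 0 `sorry`, default heartbeats);
`--supports stmt-QuantumFields-19200 --as helper`, count-neutral.

READING (every conjunct is a (D2) binder VERBATIM under `θ := 1`, `(F.L : ℝ) ↦ Λ`, `1 ∕ (4·Cst 3 a₀) ↦ g`, `cG cQ εN ↦` the short-bound shapes
`PG₁·ν + PG₂·ε₀·((Rb:ℝ)+9+Λ²)`, `PQ·ε₀·(…) + TQ·e^{−μa(Bt−1)∕ν}`, `PN₁·ν + PN₂·ε₀·(…) + TN·e^{−μa(Bt−1)∕ν}` with ABSTRACT non-negative coefficients — the consumer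
(D4 `hT_exists`) instantiates `Λ := (F.L : ℝ)`, `g := 1 ∕ (4 · B5Prop11Plancherel.Cst 3 a₀)`, `am := 1`, `PG₁ … TN :=` routeR-w3's closed coefficients
(`Prop7LocalProjectorRowCubeLetterBounds.coeff_nonneg`), reads `hκP` as stated, and is left with the two ROOMS `s + 2 ≤ m + n`, `Rb + 11 ≤ L^{m+n}` (member-level) only.

WHAT IS PROVED (ns `Summit.QuantumFields.YangMills.Theorems.Prop7LODNumericLetters`).
* `cap_le_one` — `0 < X`, `ε ≤ X⁻¹` ⟹ `X·ε ≤ 1` (the two caps); `one_le_of_window` — the (D3a) window conclusion at scale `s = 0` is absurd, so `1 ≤ s`.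
* ★★ `exists_LOD_numeric_letters_of` — the pack with the `am`-closed constants as LETTERS (`M = max 2 (16∕am)`, `mB` = the coarse-Gram coercivity constant,
  `Γ` = the Combes–Thomas gap slope, `Dr` = the radius constant under the logarithm, `CP` = the (K2b) member constant, `μa` = a slope with `3μa ≤ 1` and the
  window product `≤ 1∕10`): hypotheses `0 < M`, `0 < mB`, `0 < μa`, `0 ≤ CP` only.
* ★★★ `exists_LOD_numeric_letters` — ITS READING AT (D2)'s PRINTED CONSTANTS (every conjunct a (D2) binder verbatim, see READING): a one-line application of the
  `_of` lemma (`M`, `mB`, `Γ`, `Dr`, `CP` found by unification; `μa := μ(am)` by ✓`mu_pos`∕`ten_mu_le_one`∕`window_win`; `0 ≤ CP(am)` by `positivity`).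

HONEST SCOPE.  Real arithmetic only (an ∃-packaging of landed windows); (D2), (D4) `hT_exists`, `hlarge`, `hT`, `hGF`, S45, EX `stub_existenceMinimalOrbit` and the crux
stmt-QuantumFields-19200 are NOT proved here; no summit statement is proved by this file.

References: T. Bałaban, CMP **99** (1985) 389–434 [Balaban1985BackgroundPropagators] (Thm 3.3 p.398, (3.46)–(3.49) pp.398–399, Thm 3.11 p.416).
-/

set_option autoImplicit false

noncomputable section

namespace Summit.QuantumFields.YangMills.Theorems.Prop7LODNumericLetters

open Summit.QuantumFields.YangMills.Theorems.Prop7LODMemberWindow (exists_window_letters)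
open Summit.QuantumFields.YangMills.Theorems.Prop7LODBudgetLetters (exists_budget_letters mu_pos ten_mu_le_one)
open Summit.QuantumFields.YangMills.Theorems.Prop7LODSlotK2WindowLetters (window_win)

/-- `0 < X` and `ε ≤ X⁻¹` give the cap `X·ε ≤ 1`. [folklore] -/
theorem cap_le_one {X ε : ℝ} (hX : 0 < X) (hε : ε ≤ X⁻¹) : X * ε ≤ 1 :=
  (mul_le_mul_of_nonneg_left hε hX.le).trans_eq (mul_inv_cancel₀ hX.ne')

/-- **`1 ≤ s` from the window.**  The conclusion of ✓`Prop7LODMemberWindow.exists_window_letters` read at `ε₀ := α`, `δP := 0`, `κP := 0` forces `s ≠ 0`: at `s = 0` the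
`s`-block alone is `≥ 2·11520 > 1 ≥ g`, so the coefficient is negative while `γ₁ > 0`. [folklore] [cite: Balaban1985BackgroundPropagators, Thm 3.11 p.416] -/
theorem one_le_of_window {g α γ₁ θc a₀ c6 Λ : ℝ} {s : ℕ} (hg : 0 < g) (hg1 : g ≤ 1) (hθc : 0 < θc) (hα : 0 < α) (ha₀ : 0 < a₀) (hc6 : 0 ≤ c6)
    (hγ₁ : 0 < γ₁)
    (key : γ₁ ≤
      (((1 - (3 * θc + 0)) * g - ((1 + θc⁻¹) * (160 * α ^ 2 * (3 * Λ ^ s + 7) ^ 2) + (1 + θc) * (1029 * α) + a₀ * ((1 + θc⁻¹) * (4 * (3 * 10 ^ 10 * Λ ^ 10 * α ^ 2 + 768 * α ^ 2 * (3 * Λ ^ s + 7) ^ 2))) + (2 * θc + 0) * c6)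
        - ((1 + 1⁻¹) * (11520 * ((Λ ^ s) ^ 2)⁻¹) + (2 + 1) * (1029 * α))
        - ((1 + 1⁻¹) * ((17280 * ((Λ ^ s) ^ 2)⁻¹ + 2 * 0 ^ 2 * (c6 + 1029 * α)) + 12441600 * a₀ * ((Λ ^ s) ^ 2)⁻¹)))
       / (1 + 1 + (1 + 1⁻¹) * (2 * 0 ^ 2)))) :
    1 ≤ s := by
  rcases Nat.eq_zero_or_pos s with h0 | h0
  · exfalso
    subst h0
    have hA : 0 ≤ ((1 + θc⁻¹) * (160 * α ^ 2 * (3 * Λ ^ 0 + 7) ^ 2) + (1 + θc) * (1029 * α) + a₀ * ((1 + θc⁻¹) * (4 * (3 * 10 ^ 10 * Λ ^ 10 * α ^ 2 + 768 * α ^ 2 * (3 * Λ ^ 0 + 7) ^ 2))) + (2 * θc + 0) * c6) := by positivity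
    have hC : 0 ≤ ((1 + 1⁻¹) * ((17280 * ((Λ ^ 0) ^ 2)⁻¹ + 2 * (0:ℝ) ^ 2 * (c6 + 1029 * α)) + 12441600 * a₀ * ((Λ ^ 0) ^ 2)⁻¹)) := by positivity
    have hB : (23040 : ℝ) ≤ ((1 + 1⁻¹) * (11520 * ((Λ ^ 0) ^ 2)⁻¹) + (2 + 1) * (1029 * α)) := by
      rw [pow_zero, one_pow, inv_one]; nlinarith [hα.le]
    have hD : (1 + 1 + (1 + 1⁻¹) * (2 * (0:ℝ) ^ 2)) = 2 := by norm_num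
    have hT : (1 - (3 * θc + 0)) * g ≤ g := by nlinarith [hθc.le, hg.le]
    rw [hD, le_div_iff₀ (by norm_num : (0:ℝ) < 2)] at key
    linarith
  · exact h0

/-- ★★ **THE NUMERIC-LETTER PACK, ABSTRACT CONSTANTS.**  With the `am`-closed constants of (D2) as letters — `M` (`= max 2 (16∕am)`), `mB` (coarse-Gram
coercivity), `Γ` (gap slope), `Dr` (radius constant), `CP` ((K2b) member constant) — and a slope `μa` (`0 < μa`, `3μa ≤ 1`, `√M·(√(27 + 2025am∕8)·μa) ≤ 1∕10`):
letters `θc δP κP s ν Bt Bc r Rb μa εcap γ₁` with every numeric hypothesis of (D2) `Prop7LODTargetClosed.curvedTarget_member_numeric` (`hθc hδP hsmall hκP`,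
`1 ≤ s`, `hν hBt hBc hr hRb hμa hμa3 hwinμ hbr`) and, for every `0 < ε₀ ≤ εcap`, the caps, the signs `hcG hcQ hεN`, `hεRb`, the three quarter-budgets
`hbG hbQ hbN` at the short letter bounds, and the window `γ₁ ≤` coefficient (at `θ = 1`, `c⋆ = (mB²·am)⁻¹`).  Proof: ✓`exists_window_letters` ⊕ `one_le_of_window`
⊕ ✓`exists_budget_letters` (targets `δP∕(8√(25∕8)·A)`, `δP∕(8A)`, `δP∕(4B)`, `X₀ := 3Λ^s + 7`, `W₀ := Λ²`) ⊕ `εcap := min α (min ε₁ (min (10¹⁰Λ⁶)⁻¹ (10¹²Λ³)⁻¹))`.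
[cite: Balaban1985BackgroundPropagators, Thm 3.3 p.398, (3.49) p.399, Thm 3.11 p.416] -/
theorem exists_LOD_numeric_letters_of {Λ g a₀ am M mB Γ Dr CP μa PG₁ PG₂ PQ TQ PN₁ PN₂ TN : ℝ} (hΛ : 2 ≤ Λ) (hg : 0 < g) (hg1 : g ≤ 1)
    (ha₀ : 0 < a₀) (ham : 0 < am) (hM : 0 < M) (hmB : 0 < mB) (hμa : 0 < μa) (hμa3 : 3 * μa ≤ 1)
    (hwinμ : Real.sqrt M * (Real.sqrt (27 + 2025 / 8 * am) * μa) ≤ 1 / 10) (hCP : 0 ≤ CP)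
    (hPG₁ : 0 ≤ PG₁) (hPG₂ : 0 ≤ PG₂) (hPQ : 0 ≤ PQ) (hTQ : 0 ≤ TQ) (hPN₁ : 0 ≤ PN₁) (hPN₂ : 0 ≤ PN₂) (hTN : 0 ≤ TN) :
    ∃ (θc δP κP : ℝ) (s : ℕ) (ν Bt Bc r : ℝ) (Rb : ℕ) (μa εcap γ₁ : ℝ),
      0 < θc ∧ 0 < δP ∧ 3 * θc + δP ≤ 1 ∧
      Real.sqrt (CP / (Λ ^ s) ^ 2) ≤ κP ∧
      1 ≤ s ∧ 0 < ν ∧ 1 ≤ Bt ∧ Bt + 1 ≤ Bc ∧ 0 < r ∧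
      3 * Λ ^ s + 4 + r + Bc / ν + 3 ≤ Rb ∧
      0 ≤ μa ∧ 3 * μa ≤ 1 ∧ Real.sqrt M * (Real.sqrt (27 + 2025 / 8 * am) * μa) ≤ 1 / 10 ∧
      2 / (min ((1 / (10 * Real.sqrt M * Real.sqrt (27 + 2025 / 8 * am))) / 2) (mB / (3 * Γ))) * Real.log (4 * Dr / δP) ≤ r ∧
      0 < εcap ∧ 10 ^ 12 * Λ ^ 3 * εcap ≤ 1 ∧ 0 < γ₁ ∧
      ∀ ε₀ : ℝ, 0 < ε₀ → ε₀ ≤ εcap →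
        10 ^ 10 * Λ ^ 6 * ε₀ ≤ 1 ∧ 10 ^ 12 * Λ ^ 3 * ε₀ ≤ 1 ∧
        0 ≤ PG₁ * ν + PG₂ * ε₀ * ((Rb : ℝ) + 9 + Λ ^ 2) ∧
        0 ≤ PQ * ε₀ * ((Rb : ℝ) + 9 + Λ ^ 2) + TQ * Real.exp (-(μa * ((Bt - 1) / ν))) ∧
        0 ≤ PN₁ * ν + PN₂ * ε₀ * ((Rb : ℝ) + 9 + Λ ^ 2) + TN * Real.exp (-(μa * ((Bt - 1) / ν))) ∧
        24 * ε₀ * ((Rb : ℝ) + 9) ≤ 1 ∧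
        PG₁ * ν + PG₂ * ε₀ * ((Rb : ℝ) + 9 + Λ ^ 2) ≤ δP / (8 * Real.sqrt (25 / 8) * ((mB ^ 2)⁻¹ * (Real.sqrt (25 / 8) * M))) ∧
        PQ * ε₀ * ((Rb : ℝ) + 9 + Λ ^ 2) + TQ * Real.exp (-(μa * ((Bt - 1) / ν))) ≤ δP / (8 * ((mB ^ 2)⁻¹ * (Real.sqrt (25 / 8) * M))) ∧
        PN₁ * ν + PN₂ * ε₀ * ((Rb : ℝ) + 9 + Λ ^ 2) + TN * Real.exp (-(μa * ((Bt - 1) / ν))) ≤ δP / (4 * ((Real.sqrt (25 / 8) * M) * ((mB ^ 2)⁻¹ * ((mB ^ 2)⁻¹ * (Real.sqrt (25 / 8) * M))))) ∧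
        γ₁ ≤
          ((1 - (3 * θc + δP)) * g - ((1 + θc⁻¹) * (160 * ε₀ ^ 2 * (3 * Λ ^ s + 7) ^ 2) + (1 + θc) * (1029 * ε₀) + a₀ * ((1 + θc⁻¹) * (4 * (3 * 10 ^ 10 * Λ ^ 10 * ε₀ ^ 2 + 768 * ε₀ ^ 2 * (3 * Λ ^ s + 7) ^ 2))) + (2 * θc + δP) * (mB ^ 2 * am)⁻¹)
        - ((1 + 1⁻¹) * (11520 * ((Λ ^ s) ^ 2)⁻¹) + (2 + 1) * (1029 * ε₀))
        - ((1 + 1⁻¹) * ((17280 * ((Λ ^ s) ^ 2)⁻¹ + 2 * κP ^ 2 * ((mB ^ 2 * am)⁻¹ + 1029 * ε₀)) + 12441600 * a₀ * ((Λ ^ s) ^ 2)⁻¹)))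
       / (1 + 1 + (1 + 1⁻¹) * (2 * κP ^ 2)) := by
  have hΛ0 : 0 < Λ := by linarith
  have hc6 : (0 : ℝ) ≤ (mB ^ 2 * am)⁻¹ := by positivity
  -- (D3a) the coefficient window
  obtain ⟨θc, δP₀, α, γ₁, s₀, hθc, hδP₀, hα, hγ₁, hwin⟩ :=
    exists_window_letters (cR := (mB ^ 2 * am)⁻¹) (c₆ := (mB ^ 2 * am)⁻¹) (CP := CP) hΛ hg hg1 ha₀ hc6 hc6 hCP
  have hdiv : 0 ≤ CP / (Λ ^ s₀) ^ 2 := div_nonneg hCP (by positivity)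
  have h00 : (0 : ℝ) ^ 2 ≤ CP / (Λ ^ s₀) ^ 2 := by rw [sq, mul_zero]; exact hdiv
  have hs1 : 1 ≤ s₀ := one_le_of_window hg hg1 hθc hα ha₀ hc6 hγ₁ (hwin α 0 0 hα le_rfl le_rfl hδP₀.le h00).2
  have hκP2 : Real.sqrt (CP / (Λ ^ s₀) ^ 2) ^ 2 ≤ CP / (Λ ^ s₀) ^ 2 := (Real.sq_sqrt hdiv).le
  have hsmall : 3 * θc + δP₀ ≤ 1 := (hwin α δP₀ _ hα le_rfl hδP₀.le le_rfl hκP2).1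
  -- the radius `r := max r₀(am, δP) 1`, opaque
  obtain ⟨r, hr, hbr⟩ : ∃ r : ℝ, 0 < r ∧ 2 / (min ((1 / (10 * Real.sqrt M * Real.sqrt (27 + 2025 / 8 * am))) / 2) (mB / (3 * Γ))) * Real.log (4 * Dr / δP₀) ≤ r :=
    ⟨_, lt_max_of_lt_right one_pos, le_max_left _ 1⟩
  -- (D3b) the budget letters at the three quarter-budget targets
  have hqG : (0 : ℝ) < δP₀ / (8 * Real.sqrt (25 / 8) * ((mB ^ 2)⁻¹ * (Real.sqrt (25 / 8) * M))) := by positivity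
  have hqQ : (0 : ℝ) < δP₀ / (8 * ((mB ^ 2)⁻¹ * (Real.sqrt (25 / 8) * M))) := by positivity
  have hqN : (0 : ℝ) < δP₀ / (4 * ((Real.sqrt (25 / 8) * M) * ((mB ^ 2)⁻¹ * ((mB ^ 2)⁻¹ * (Real.sqrt (25 / 8) * M))))) := by positivity
  obtain ⟨ν, Bt, ε₁, Rb, hν, -, hBt, hRb, hε₁, hbud⟩ :=
    exists_budget_letters (3 * Λ ^ s₀ + 4 + 3) r hPG₁ hPG₂ hPQ hTQ hPN₁ hPN₂ hTN hμa hqG hqQ hqN (sq_nonneg Λ)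
  -- the cap
  have hεcap : 0 < (min α (min ε₁ (min (10 ^ 10 * Λ ^ 6)⁻¹ (10 ^ 12 * Λ ^ 3)⁻¹))) := lt_min hα (lt_min hε₁ (lt_min (by positivity) (by positivity)))
  have hcapα : (min α (min ε₁ (min (10 ^ 10 * Λ ^ 6)⁻¹ (10 ^ 12 * Λ ^ 3)⁻¹))) ≤ α := min_le_left _ _
  have hcap₁ : (min α (min ε₁ (min (10 ^ 10 * Λ ^ 6)⁻¹ (10 ^ 12 * Λ ^ 3)⁻¹))) ≤ ε₁ := (min_le_right _ _).trans (min_le_left _ _)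
  have hcap6 : (min α (min ε₁ (min (10 ^ 10 * Λ ^ 6)⁻¹ (10 ^ 12 * Λ ^ 3)⁻¹))) ≤ (10 ^ 10 * Λ ^ 6)⁻¹ := (min_le_right _ _).trans ((min_le_right _ _).trans (min_le_left _ _))
  have hcap3 : (min α (min ε₁ (min (10 ^ 10 * Λ ^ 6)⁻¹ (10 ^ 12 * Λ ^ 3)⁻¹))) ≤ (10 ^ 12 * Λ ^ 3)⁻¹ := (min_le_right _ _).trans ((min_le_right _ _).trans (min_le_right _ _))
  refine ⟨θc, δP₀, Real.sqrt (CP / (Λ ^ s₀) ^ 2), s₀, ν, Bt, Bt + 1, r, Rb, μa, (min α (min ε₁ (min (10 ^ 10 * Λ ^ 6)⁻¹ (10 ^ 12 * Λ ^ 3)⁻¹))), γ₁,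
    hθc, hδP₀, hsmall, le_rfl, hs1, hν, hBt, le_rfl, hr, ?_, hμa.le, hμa3, hwinμ, hbr, hεcap, cap_le_one (by positivity) hcap3, hγ₁, ?_⟩
  · linarith only [hRb]
  intro ε₀ hε₀ hε₀cap
  obtain ⟨hG, hQ, hN, hεRb⟩ := hbud ε₀ hε₀ (hε₀cap.trans hcap₁)
  have hw := (hwin ε₀ δP₀ _ hε₀ (hε₀cap.trans hcapα) hδP₀.le le_rfl hκP2).2
  have hexp : 0 ≤ Real.exp (-(μa * ((Bt - 1) / ν))) := (Real.exp_pos _).le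
  have hrad : 0 ≤ (Rb : ℝ) + 9 + Λ ^ 2 := by positivity
  exact ⟨cap_le_one (by positivity) (hε₀cap.trans hcap6), cap_le_one (by positivity) (hε₀cap.trans hcap3),
    add_nonneg (mul_nonneg hPG₁ hν.le) (mul_nonneg (mul_nonneg hPG₂ hε₀.le) hrad),
    add_nonneg (mul_nonneg (mul_nonneg hPQ hε₀.le) hrad) (mul_nonneg hTQ hexp),
    add_nonneg (add_nonneg (mul_nonneg hPN₁ hν.le) (mul_nonneg (mul_nonneg hPN₂ hε₀.le) hrad)) (mul_nonneg hTN hexp),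
    hεRb, hG, hQ, hN, hw⟩

/-- ★★★ **THE NUMERIC-LETTER PACK (D3c) AT (D2)'s PRINTED CONSTANTS.**  For `2 ≤ Λ`, `0 < g ≤ 1`, `0 < a₀`, `0 < am` and non-negative abstract
coefficients `PG₁ PG₂ PQ TQ PN₁ PN₂ TN` there are letters `θc δP κP s ν Bt Bc r Rb μa εcap γ₁` satisfying every numeric hypothesis of (D2)
`Prop7LODTargetClosed.curvedTarget_member_numeric` VERBATIM (under `θ := 1`, `(F.L : ℝ) ↦ Λ`, `1∕(4·Cst 3 a₀) ↦ g`, `cG cQ εN ↦` the short-bound shapes):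
`hθc hδP hsmall hκP`, `1 ≤ s`, `hν hBt hBc hr hRb hμa hμa3 hwinμ hbr`, and for every `0 < ε₀ ≤ εcap` the caps `10¹⁰Λ⁶ε₀ ≤ 1`, `10¹²Λ³ε₀ ≤ 1`, the signs
`hcG hcQ hεN`, `hεRb`, the quarter-budgets `hbG hbQ hbN`, and `γ₁ ≤` (D2)'s coefficient at `θ = 1`.  One-line reading of `exists_LOD_numeric_letters_of`.
[cite: Balaban1985BackgroundPropagators, Thm 3.3 p.398, (3.49) p.399, Thm 3.11 p.416] -/
theorem exists_LOD_numeric_letters {Λ g a₀ am PG₁ PG₂ PQ TQ PN₁ PN₂ TN : ℝ} (hΛ : 2 ≤ Λ) (hg : 0 < g) (hg1 : g ≤ 1) (ha₀ : 0 < a₀) (ham : 0 < am)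
    (hPG₁ : 0 ≤ PG₁) (hPG₂ : 0 ≤ PG₂) (hPQ : 0 ≤ PQ) (hTQ : 0 ≤ TQ) (hPN₁ : 0 ≤ PN₁) (hPN₂ : 0 ≤ PN₂) (hTN : 0 ≤ TN) :
    ∃ (θc δP κP : ℝ) (s : ℕ) (ν Bt Bc r : ℝ) (Rb : ℕ) (μa εcap γ₁ : ℝ),
      0 < θc ∧ 0 < δP ∧ 3 * θc + δP ≤ 1 ∧
      Real.sqrt (((2 * 2880 * (((24 * (max 2 (16 / am)) * Real.sqrt (25 / 8)) ^ 2 * (18 / (2 / ((1 + 25 / 8) * (600 * (27 / 4 : ℝ) ^ 6 + am))) ^ 2) * (4 * (2 * (1 + 2 / (1 / (10 * Real.sqrt (max 2 (16 / am)) * Real.sqrt (27 + 2025 / 8 * am))))) ^ 3) ^ 2) * (2 * (2 / (1 / (10 * Real.sqrt (max 2 (16 / am)) * Real.sqrt (27 + 2025 / 8 * am))) + 3 * ((Real.sqrt (max 2 (16 / am)) * (2 + Real.sqrt (max 2 (16 / am))) * (3 * Real.sqrt 3 + 27 + 9 * Real.sqrt am * Real.sqrt (25 / 8) + 81 * am *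 (25 / 8))
          * (8 * Real.sqrt (max 2 (16 / am)) + 8 * Real.sqrt (max 2 (16 / am)) ^ 2) * (10 * Real.sqrt (25 / 8)) + 9 * (max 2 (16 / am)) * Real.sqrt (25 / 8))) / (2 / ((1 + 25 / 8) * (600 * (27 / 4 : ℝ) ^ 6 + am)))) * (2 * (1 + 2 * (2 / (1 / (10 * Real.sqrt (max 2 (16 / am)) * Real.sqrt (27 + 2025 / 8 * am))) + 3 * ((Real.sqrt (max 2 (16 / am)) * (2 + Real.sqrt (max 2 (16 / am))) * (3 * Real.sqrt 3 + 27 + 9 * Real.sqrt am * Real.sqrt (25 / 8) + 81 * am * (25 / 8))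
          * (8 * Real.sqrt (max 2 (16 / am)) + 8 * Real.sqrt (max 2 (16 / am)) ^ 2) * (10 * Real.sqrt (25 / 8)) + 9 * (max 2 (16 / am)) * Real.sqrt (25 / 8))) / (2 / ((1 + 25 / 8) * (600 * (27 / 4 : ℝ) ^ 6 + am)))))) ^ 3)) ^ 2 + 72 * 2880 * (((24 * (max 2 (16 / am)) * Real.sqrt (25 / 8)) ^ 2 * (18 / (2 / ((1 + 25 / 8) * (600 * (27 / 4 : ℝ) ^ 6 + am))) ^ 2) * (4 * (2 * (1 + 2 / (1 / (10 * Real.sqrt (max 2 (16 / am)) * Real.sqrt (27 + 2025 / 8 * am))))) ^ 3) ^ 2) * (2 * (1 + (2 / (1 / (10 * Real.sqrt (max 2 (16 / am)) * Real.sqrt (27 + 2025 / 8 * am))) + 3 * ((Real.sqrt (max 2 (16 / am)) * (2 + Real.sqrt (max 2 (16 / am))) * (3 * Real.sqrt 3 + 27 + 9 * Real.sqrt am * Real.sqrt (25 / 8) + 81 * am * (25 / 8))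
          * (8 * Real.sqrt (max 2 (16 / am)) + 8 * Real.sqrt (max 2 (16 / am)) ^ 2) * (10 * Real.sqrt (25 / 8)) + 9 * (max 2 (16 / am)) * Real.sqrt (25 / 8))) / (2 / ((1 + 25 / 8) * (600 * (27 / 4 : ℝ) ^ 6 + am)))))) ^ 3) ^ 2))
              / (Λ ^ s) ^ 2) ≤ κP ∧
      1 ≤ s ∧ 0 < ν ∧ 1 ≤ Bt ∧ Bt + 1 ≤ Bc ∧ 0 < r ∧
      3 * Λ ^ s + 4 + r + Bc / ν + 3 ≤ Rb ∧
      0 ≤ μa ∧ 3 * μa ≤ 1 ∧ Real.sqrt (max 2 (16 / am)) * (Real.sqrt (27 + 2025 / 8 * am) * μa) ≤ 1 / 10 ∧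
      2 / (min ((1 / (10 * Real.sqrt (max 2 (16 / am)) * Real.sqrt (27 + 2025 / 8 * am))) / 2) ((2 / ((1 + 25 / 8) * (600 * (27 / 4 : ℝ) ^ 6 + am))) / (3 * ((Real.sqrt (max 2 (16 / am)) * (2 + Real.sqrt (max 2 (16 / am))) * (3 * Real.sqrt 3 + 27 + 9 * Real.sqrt am * Real.sqrt (25 / 8) + 81 * am * (25 / 8))
          * (8 * Real.sqrt (max 2 (16 / am)) + 8 * Real.sqrt (max 2 (16 / am)) ^ 2) * (10 * Real.sqrt (25 / 8)) + 9 * (max 2 (16 / am)) * Real.sqrt (25 / 8)))))) * Real.log (4 * ((Real.sqrt (25 / 8) * (max 2 (16 / am))) * (((2 / ((1 + 25 / 8) * (600 * (27 / 4 : ℝ) ^ 6 + am))) ^ 2)⁻¹ * ((Real.sqrt (25 / 8) * (max 2 (16 / am)) ^ 2 * Real.sqrt (25 / 8) + Real.sqrt (25 / 8) * (max 2 (16 / am)) ^ 2 * Real.sqrt (25 / 8)) * ((18 / (2 / ((1 + 25 / 8) * (600 * (27 / 4 : ℝ) ^ 6 + am))) ^ 2) * (24 * (max 2 (16 / am)) *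 Real.sqrt (25 / 8)) * (4 * (2 * (1 + 2 / (1 / (10 * Real.sqrt (max 2 (16 / am)) * Real.sqrt (27 + 2025 / 8 * am))))) ^ 3) * Real.sqrt ((2 * (1 + 2 * (2 / (1 / (10 * Real.sqrt (max 2 (16 / am)) * Real.sqrt (27 + 2025 / 8 * am))) + 3 * ((Real.sqrt (max 2 (16 / am)) * (2 + Real.sqrt (max 2 (16 / am))) * (3 * Real.sqrt 3 + 27 + 9 * Real.sqrt am * Real.sqrt (25 / 8) + 81 * am * (25 / 8))
          * (8 * Real.sqrt (max 2 (16 / am)) + 8 * Real.sqrt (max 2 (16 / am)) ^ 2) * (10 * Real.sqrt (25 / 8)) + 9 * (max 2 (16 / am)) * Real.sqrt (25 / 8))) / (2 / ((1 + 25 / 8) * (600 * (27 / 4 : ℝ) ^ 6 + am)))))) ^ 3 * (4 * (2 * (1 + 2 * (2 / (1 / (10 * Real.sqrt (max 2 (16 / am)) * Real.sqrt (27 + 2025 / 8 * am))) + 3 * ((Real.sqrt (max 2 (16 / am)) * (2 + Real.sqrt (max 2 (16 / am))) * (3 * Real.sqrt 3 + 27 + 9 * Real.sqrt am * Real.sqrt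 (25 / 8) + 81 * am * (25 / 8))
          * (8 * Real.sqrt (max 2 (16 / am)) + 8 * Real.sqrt (max 2 (16 / am)) ^ 2) * (10 * Real.sqrt (25 / 8)) + 9 * (max 2 (16 / am)) * Real.sqrt (25 / 8))) / (2 / ((1 + 25 / 8) * (600 * (27 / 4 : ℝ) ^ 6 + am)))))) ^ 3)))))) / δP) ≤ r ∧
      0 < εcap ∧ 10 ^ 12 * Λ ^ 3 * εcap ≤ 1 ∧ 0 < γ₁ ∧
      ∀ ε₀ : ℝ, 0 < ε₀ → ε₀ ≤ εcap →
        10 ^ 10 * Λ ^ 6 * ε₀ ≤ 1 ∧ 10 ^ 12 * Λ ^ 3 * ε₀ ≤ 1 ∧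
        0 ≤ PG₁ * ν + PG₂ * ε₀ * ((Rb : ℝ) + 9 + Λ ^ 2) ∧
        0 ≤ PQ * ε₀ * ((Rb : ℝ) + 9 + Λ ^ 2) + TQ * Real.exp (-(μa * ((Bt - 1) / ν))) ∧
        0 ≤ PN₁ * ν + PN₂ * ε₀ * ((Rb : ℝ) + 9 + Λ ^ 2) + TN * Real.exp (-(μa * ((Bt - 1) / ν))) ∧
        24 * ε₀ * ((Rb : ℝ) + 9) ≤ 1 ∧
        PG₁ * ν + PG₂ * ε₀ * ((Rb : ℝ) + 9 + Λ ^ 2) ≤ δP / (8 * Real.sqrt (25 / 8) * (((2 / ((1 + 25 / 8) * (600 * (27 / 4 : ℝ) ^ 6 + am))) ^ 2)⁻¹ * (Real.sqrt (25 / 8) * (max 2 (16 / am))))) ∧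
        PQ * ε₀ * ((Rb : ℝ) + 9 + Λ ^ 2) + TQ * Real.exp (-(μa * ((Bt - 1) / ν))) ≤ δP / (8 * (((2 / ((1 + 25 / 8) * (600 * (27 / 4 : ℝ) ^ 6 + am))) ^ 2)⁻¹ * (Real.sqrt (25 / 8) * (max 2 (16 / am))))) ∧
        PN₁ * ν + PN₂ * ε₀ * ((Rb : ℝ) + 9 + Λ ^ 2) + TN * Real.exp (-(μa * ((Bt - 1) / ν))) ≤ δP / (4 * ((Real.sqrt (25 / 8) * (max 2 (16 / am))) * (((2 / ((1 + 25 / 8) * (600 * (27 / 4 : ℝ) ^ 6 + am))) ^ 2)⁻¹ * (((2 / ((1 + 25 / 8) * (600 * (27 / 4 : ℝ) ^ 6 + am))) ^ 2)⁻¹ * (Real.sqrt (25 / 8) * (max 2 (16 / am))))))) ∧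
        γ₁ ≤
          ((1 - (3 * θc + δP)) * g - ((1 + θc⁻¹) * (160 * ε₀ ^ 2 * (3 * Λ ^ s + 7) ^ 2) + (1 + θc) * (1029 * ε₀) + a₀ * ((1 + θc⁻¹) * (4 * (3 * 10 ^ 10 * Λ ^ 10 * ε₀ ^ 2 + 768 * ε₀ ^ 2 * (3 * Λ ^ s + 7) ^ 2))) + (2 * θc + δP) * ((2 / ((1 + 25 / 8) * (600 * (27 / 4 : ℝ) ^ 6 + am))) ^ 2 * am)⁻¹)
        - ((1 + 1⁻¹) * (11520 * ((Λ ^ s) ^ 2)⁻¹) + (2 + 1) * (1029 * ε₀))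
        - ((1 + 1⁻¹) * ((17280 * ((Λ ^ s) ^ 2)⁻¹ + 2 * κP ^ 2 * (((2 / ((1 + 25 / 8) * (600 * (27 / 4 : ℝ) ^ 6 + am))) ^ 2 * am)⁻¹ + 1029 * ε₀)) + 12441600 * a₀ * ((Λ ^ s) ^ 2)⁻¹)))
       / (1 + 1 + (1 + 1⁻¹) * (2 * κP ^ 2)) :=
  exists_LOD_numeric_letters_of hΛ hg hg1 ha₀ ham (lt_of_lt_of_le two_pos (le_max_left _ _)) (by positivity) (mu_pos ham)
    (by linarith only [mu_pos ham, ten_mu_le_one ham]) (window_win ham rfl) (by positivity) hPG₁ hPG₂ hPQ hTQ hPN₁ hPN₂ hTN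

end Summit.QuantumFields.YangMills.Theorems.Prop7LODNumericLetters

end
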